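import Literature.MathematicalPhysics.QuantumFieldTheory.Balaban1983to89.B8Prop6DentedCubeMemberScalarGammaOfGBound
import Literature.MathematicalPhysics.QuantumFieldTheory.Balaban1983to89.B8Ineq159FlatDentedCubeMemberTransplant
import Literature.MathematicalPhysics.QuantumFieldTheory.Balaban1983to89.B8Thm32GBoundDentedCubeMemberHolds

/-!
# `Balaban1983to89.B8Prop6DentedCubeMemberScalarGammaOfReal1` — [Balaban1985RegularSpaces] PROPOSITION 6 (p. 99) AS `Node00.GaugedBoundB8D` AT EVERY DENTED CUBE
# MEMBER OF [Balaban1985Variational] (148)–(150), ODD `L ≥ 5`: THE (β) CROWN WITH ITS (1.59)♭ AND 𝒢-BOUND INPUTS DISCHARGED — conditional ONLY on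
# [Balaban1985BackgroundPropagators] Theorem 3.1 ∕ [Balaban1985RegularSpaces] (1.101) for `T⁻¹` on the dented member (`Real1Dented…`, `Real1M4Dented…`)

statement-level skeleton of published theorems with citation tags; proofs where landed; nothing here is a claim about the
Yang–Mills mass gap

`[Balaban1985RegularSpaces]` ("B8" = [6], CMP **99** (1985) 75–102) Prop. 6 (1.135)–(1.138) p. 99, p. 98, (1.59) p. 86, (1.62) p. 87, (1.91)–(1.92) p. 91, (1.98) p. 92,
(1.101) p. 93; `[Balaban1985Variational]` ("[15]", CMP **102** (1985) 277–309) (148)–(152) p. 301, p. 300; `[Balaban1985BackgroundPropagators]` ([4], CMP **99** (1985)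
389–434) Thms 3.1–3.3 pp. 398–399; `[Balaban1984PropagatorsII]` ("B6", CMP **96** (1984) 223–250) Prop. 2.6 (2.136) p. 247.  PDF held:
`paper:balaban1985-cmp99-regular-spaces-gauge-fixing`, `paper:balaban1985-cmp102-variational-background`.

CITATION HEADER (lean-in-tree rule).  Cell `pub-ymgap` (YM Track A, HUMAN RULING D-0062), DAG node N05 = [B8], seat `pub-ymgap-dag-n05-e` (g32; FAN-OUT §N05 row s3b,
Proposition-6 lane; piece (d2-d) of the (β) road; INTENT I.43465).  WHY THIS FILE.  The (β) road's two crowns — `B8Prop6DentedCubeMemberScalarGammaOfNamedFacts` §3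
`gaugedBoundB8D_dentedMember_scalar_γ_of_dentedNamedFacts` (p669335; hypotheses `h159D`, `hR`) and `B8Prop6DentedCubeMemberScalarGammaOfGBound`
`gaugedBoundB8D_dentedMember_scalar_γ_of_gboundDented` (p670304; hypotheses `h159D`, `hR1`, `hR1'`, `hG`) — land [6] Proposition 6's conclusion as NODE 00's `GaugedBoundB8D`
at every dented cube member of print's sub-lattice CONDITIONALLY; their common first hypothesis `h159D : Ineq159FlatDentedCubeMemberPrinted d L` ([6] (1.59) ∕ [4] Thm 3.3 at
`U₀ = 1` on [15]'s `{Ω′_j}`, top truncation; p659892) is now a THEOREM for odd `L ≥ 5`: this seat's dented torus transplant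
`B8Ineq159FlatDentedCubeMemberTransplant.ineq159FlatDentedCubeMemberPrinted_holds` ((d2-c), g32); and the 𝒢-bound hypothesis `hG : GBoundDentedCubeMemberPrinted (d−1) (L−1)`
([4] Thm 3.2 (3.48) on `{Ω′_j}`; p661669) is a THEOREM for every `L ≥ 2`: this seat's dented box transfer
`B8Thm32GBoundDentedCubeMemberHolds.gBoundDentedCubeMemberPrinted_of_one_le` ((d2-e), g32).  THIS FILE discharges both BY NAME (the dented twin of the steps
`…OfIneq159Printed → B8Prop6CubeMemberScalarGammaHolds` and `…OfGBound → B8Thm32GBoundCubeMemberHolds.prop6_real123_printed` of the pure road): what remains named is [4]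
Theorem 3.1 for `T⁻¹` on the dented member in its two exponents (`Real1DentedCubeMemberPrinted`, `Real1M4DentedCubeMemberPrinted`, p669491) — exactly the input the pure
road took from dag-n05-c's parametrix (`B8Eq1101CubeMember*`), on `{Ω′_j}` — or, alternatively, the REAL triple `Real123DentedCubeMemberPrinted` (§1).

WHAT THIS FILE PROVES (kernel-checked; by-name compositions, three theorems).
* §1 ★★★ `gaugedBoundB8D_dentedMember_scalar_γ_of_real123Dented (hd2 : 2 ≤ d) (hL5 : 5 ≤ L) (hodd : Odd L) (hR : Real123DentedCubeMemberPrinted (d−1) (L−1))` — p669335 §3 with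
  `h159D` discharged.
* §2 ★★★ `gaugedBoundB8D_dentedMember_scalar_γ_of_thm312Dented (hd2) (hL5) (hodd) (hR1 : Real1DentedCubeMemberPrinted (d−1) (L−1)) (hR1' : Real1M4DentedCubeMemberPrinted (d−1) (L−1))
  (hG : GBoundDentedCubeMemberPrinted (d−1) (L−1))` — p670304's crown with `h159D` discharged: `GaugedBoundB8D L η U₀ c (7dL²·5dLB₀·c.M·α₀)` at every dented member
  `c : CubeB8D d L K Ω` on print's p. 98 sub-lattice under the anchored dent premise, every unitary `U₀ ∈ 𝔄_K(α₀)` with `7dL²Mα₀ ≤ c₁`, MODULO [4] Thms 3.1 ∕ 3.1′ ∕ 3.2 on `{Ω′_j}`.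
* §3 ★★★ `gaugedBoundB8D_dentedMember_scalar_γ_of_real1Dented (hd2) (hL5) (hodd) (hR1) (hR1')` — §2 with `hG` DISCHARGED by `gBoundDentedCubeMemberPrinted_of_one_le`: the (β) crown
  MODULO [4] Thm 3.1 ∕ [B8] (1.101) for `T⁻¹` on `{Ω′_j}` ONLY (two single-theorem named facts, p669491).
HONEST SCOPE ∕ NOT CLAIMED.  Compositions by name; the remaining hypotheses are OPEN named facts (their proof = the dented parametrix, `B8Eq1101CubeMember*`'s twin, not this file);
NO new estimate; nothing of [4]∕[6]∕[15] asserted beyond the landed theorems; count-neutral; N05 ∕ N07 NOT discharged; one finite `T⁴` programme at fixed `ε`, Bałaban as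
printed; nothing continuum ∕ ℝ⁴ ∕ OS ∕ mass-gap ∕ Clay.  No `sorry`, no `def`, no `instance`, no `notation`.  Unit `pub-ymgap-dag-n05-e` (g32), 2026-08-28.

RELATED IN THE TREE, NOT DUPLICATED (`rg -l 'ScalarGammaOfThm312' Balaban1983to89` = 0, 2026-08-28T22:05Z): the two crowns (this seat g31; USED by name, not restated),
`B8Ineq159FlatDentedCubeMemberTransplant` (g32; USED), the pure unconditional crown `B8Prop6CubeMemberScalarGammaHolds.gaugedBoundB8_cubeMember_scalar_γ_holds` (dag-n05-c; the
model of the discharge step).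
-/

noncomputable section

namespace Literature.MathematicalPhysics.QuantumFieldTheory.Balaban1983to89.B8Prop6DentedCubeMemberScalarGammaOfReal1

open scoped Matrix
open B7Prop1Explicit B7Prop2Explicit B7Prop1Local
open B8Ineq132 (InAk)
open B8Thm32GBoundDentedCubeMember (GBoundDentedCubeMemberPrinted)
open B8Real123DentedCubeMember (Real123DentedCubeMemberPrinted)
open B8Real1DentedCubeMember (Real1DentedCubeMemberPrinted Real1M4DentedCubeMemberPrinted)
open B8Ineq159FlatDentedCubeMemberTransplant (ineq159FlatDentedCubeMemberPrinted_holds)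
open B8Thm32GBoundDentedCubeMemberHolds (gBoundDentedCubeMemberPrinted_of_one_le)
open B8Prop6DentedCubeMemberScalarGammaOfNamedFacts (gaugedBoundB8D_dentedMember_scalar_γ_of_dentedNamedFacts)
open B8Prop6DentedCubeMemberScalarGammaOfGBound (gaugedBoundB8D_dentedMember_scalar_γ_of_gboundDented)
open Node00 (CubeB8D GaugedBoundB8D)
open Literature.MathematicalPhysics.QuantumLattice (blockMap)

export B7Prop1Explicit (Site)

variable {d : ℕ} {𝔸 : Type} [CStarAlgebra 𝔸] [Nontrivial 𝔸]

/-! ## §1 The crown modulo the REAL triple only -/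

open Classical in
/-- ★★★ **PROPOSITION 6 (p. 99) AS `Node00.GaugedBoundB8D` AT EVERY DENTED CUBE MEMBER OF PRINT's BIG-BLOCK SUB-LATTICE, FOR ODD `L ≥ 5` AND `d ≥ 2`, MODULO THE REAL
TRIPLE ON THE DENTED MEMBER** — p669335 §3 `gaugedBoundB8D_dentedMember_scalar_γ_of_dentedNamedFacts` with its (1.59)♭ hypothesis `Ineq159FlatDentedCubeMemberPrinted d L`
DISCHARGED by this seat's dented torus transplant `ineq159FlatDentedCubeMemberPrinted_holds` ([4] Thm 3.3 at `U = 1` on the dented member by exact transfer to lit-balaban's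
level-0 multi-level torus estimates; odd `L ≥ 5`).  REMAINING HYPOTHESIS: the OPEN named fact `Real123DentedCubeMemberPrinted (d−1) (L−1)` (p668204).  Conclusion verbatim
the crown's. [cite: Balaban1985RegularSpaces, Prop. 6 (1.135)–(1.138) p.99, p.98, (1.59) p.86, (1.91)–(1.92) p.91, (1.98) p.92, (1.101) p.93; Balaban1985Variational, (148)–(152) p.301; Balaban1985BackgroundPropagators, Thms 3.1–3.3 pp.398–399; Balaban1984PropagatorsII, Prop. 2.6 (2.136) p.247] -/
theorem gaugedBoundB8D_dentedMember_scalar_γ_of_real123Dented (hd2 : 2 ≤ d) {L : ℕ} (hL5 : 5 ≤ L) (hodd : Odd L)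
    (hR : Real123DentedCubeMemberPrinted (d - 1) (L - 1)) :
    ∃ B₀ c₁ ρ₀ M₀ : ℝ, ∃ N₀ R₀ : ℕ, 1 ≤ B₀ ∧ 0 < c₁ ∧ ∀ (η : ℝ), 0 < η → ∀ {K : ℕ} {Ω : ℕ → Set (Site d)} (c : CubeB8D d L K Ω),
      -- PRINT'S SIDE CONDITIONS (p. 98) on the cube datum in the named facts' letters (`M_h = Lˢ`), above threshold
      ∀ (s R : ℕ), 3 ≤ L ^ s → M₀ ≤ (L : ℝ) ^ (s + 1) → L ^ (s + 1) ∣ c.ρ → L ^ (s + 1) ∣ c.M → R * L ^ (s + 1) ≤ c.ρ → 2 * L ≤ R →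
        R₀ ≤ R → N₀ + 1 ≤ R * L ^ (s + 1) → ρ₀ ≤ (c.ρ : ℝ) →
      -- THE DENT PREMISE ([6] (1.4)₂): `Ω_k` is a union of cubes of side `L^{s+1}Lᵏ` of the grid anchored at `□_k`'s fine lower corner `Lᵏ(c.a − c.ρ)`
      (∀ x y : Site d,
          blockMap (L ^ (s + 1) * L ^ c.k) (x - fun i => (L : ℤ) ^ c.k * (c.a i - c.ρ)) =
            blockMap (L ^ (s + 1) * L ^ c.k) (y - fun i => (L : ℤ) ^ c.k * (c.a i - c.ρ)) → x ∈ Ω c.k → y ∈ Ω c.k) →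
      ∀ (U₀ : Site d → Fin d → 𝔸ˣ), (∀ x κ, U₀ x κ ∈ unitaryUnits 𝔸) → ∀ (α₀ : ℝ), 0 < α₀ → InAk L K η α₀ Ω U₀ →
      7 * d * (L : ℝ) ^ 2 * c.M * α₀ ≤ c₁ →
      GaugedBoundB8D L η U₀ c (7 * d * (L : ℝ) ^ 2 * (5 * (d : ℝ) * L * B₀) * c.M * α₀) := by
  obtain ⟨d', rfl⟩ : ∃ d', d = d' + 1 := ⟨d - 1, by omega⟩
  obtain ⟨ℓ, rfl⟩ : ∃ ℓ, L = ℓ + 1 := ⟨L - 1, by omega⟩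
  exact gaugedBoundB8D_dentedMember_scalar_γ_of_dentedNamedFacts (𝔸 := 𝔸) hd2 hL5 hodd (ineq159FlatDentedCubeMemberPrinted_holds d' ℓ (by omega) hodd) hR

#print axioms gaugedBoundB8D_dentedMember_scalar_γ_of_real123Dented

/-! ## §2 The crown modulo [4] Theorems 3.1 ∕ 3.1′ ∕ 3.2 on the dented member only -/

open Classical in
/-- ★★★ **PROPOSITION 6 (p. 99) AS `Node00.GaugedBoundB8D` AT EVERY DENTED CUBE MEMBER OF PRINT's BIG-BLOCK SUB-LATTICE, FOR ODD `L ≥ 5` AND `d ≥ 2`, MODULO (1.101) FOR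
`T⁻¹` AND THE 𝒢-BOUND ON THE DENTED MEMBER** — p670304's `gaugedBoundB8D_dentedMember_scalar_γ_of_gboundDented` with its (1.59)♭ hypothesis DISCHARGED by
`ineq159FlatDentedCubeMemberPrinted_holds`.  REMAINING HYPOTHESES, each ONE printed theorem on [15]'s dented sequence `{Ω′_j}` at its top truncation, all OPEN named facts:
`Real1DentedCubeMemberPrinted (d−1) (L−1)` and `Real1M4DentedCubeMemberPrinted (d−1) (L−1)` ([4] Thm 3.1 ∕ [B8] (1.101) for `T⁻¹`; p669491), `GBoundDentedCubeMemberPrinted (d−1) (L−1)`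
([4] Thm 3.2 (3.48); p661669).  The dented twin of dag-n05-c's UNCONDITIONAL `gaugedBoundB8_cubeMember_scalar_γ_holds` up to exactly these three transfers.
[cite: Balaban1985RegularSpaces, Prop. 6 (1.135)–(1.138) p.99, p.98, (1.59) p.86, (1.91)–(1.92) p.91, (1.98) p.92, (1.101) p.93; Balaban1985Variational, (148)–(152) p.301; Balaban1985BackgroundPropagators, Thms 3.1–3.3 pp.398–399; Balaban1984PropagatorsII, Prop. 2.6 (2.136) p.247, Prop. 2.3 (2.87) p.238] -/
theorem gaugedBoundB8D_dentedMember_scalar_γ_of_thm312Dented (hd2 : 2 ≤ d) {L : ℕ} (hL5 : 5 ≤ L) (hodd : Odd L)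
    (hR1 : Real1DentedCubeMemberPrinted (d - 1) (L - 1)) (hR1' : Real1M4DentedCubeMemberPrinted (d - 1) (L - 1))
    (hG : GBoundDentedCubeMemberPrinted (d - 1) (L - 1)) :
    ∃ B₀ c₁ ρ₀ M₀ : ℝ, ∃ N₀ R₀ : ℕ, 1 ≤ B₀ ∧ 0 < c₁ ∧ ∀ (η : ℝ), 0 < η → ∀ {K : ℕ} {Ω : ℕ → Set (Site d)} (c : CubeB8D d L K Ω),
      -- PRINT'S SIDE CONDITIONS (p. 98) on the cube datum in the named facts' letters (`M_h = Lˢ`), above threshold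
      ∀ (s R : ℕ), 3 ≤ L ^ s → M₀ ≤ (L : ℝ) ^ (s + 1) → L ^ (s + 1) ∣ c.ρ → L ^ (s + 1) ∣ c.M → R * L ^ (s + 1) ≤ c.ρ → 2 * L ≤ R →
        R₀ ≤ R → N₀ + 1 ≤ R * L ^ (s + 1) → ρ₀ ≤ (c.ρ : ℝ) →
      -- THE DENT PREMISE ([6] (1.4)₂): `Ω_k` is a union of cubes of side `L^{s+1}Lᵏ` of the grid anchored at `□_k`'s fine lower corner `Lᵏ(c.a − c.ρ)`
      (∀ x y : Site d,
          blockMap (L ^ (s + 1) * L ^ c.k) (x - fun i => (L : ℤ) ^ c.k * (c.a i - c.ρ)) =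
            blockMap (L ^ (s + 1) * L ^ c.k) (y - fun i => (L : ℤ) ^ c.k * (c.a i - c.ρ)) → x ∈ Ω c.k → y ∈ Ω c.k) →
      ∀ (U₀ : Site d → Fin d → 𝔸ˣ), (∀ x κ, U₀ x κ ∈ unitaryUnits 𝔸) → ∀ (α₀ : ℝ), 0 < α₀ → InAk L K η α₀ Ω U₀ →
      7 * d * (L : ℝ) ^ 2 * c.M * α₀ ≤ c₁ →
      GaugedBoundB8D L η U₀ c (7 * d * (L : ℝ) ^ 2 * (5 * (d : ℝ) * L * B₀) * c.M * α₀) := by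
  obtain ⟨d', rfl⟩ : ∃ d', d = d' + 1 := ⟨d - 1, by omega⟩
  obtain ⟨ℓ, rfl⟩ : ∃ ℓ, L = ℓ + 1 := ⟨L - 1, by omega⟩
  exact gaugedBoundB8D_dentedMember_scalar_γ_of_gboundDented (𝔸 := 𝔸) hd2 hL5 hodd (ineq159FlatDentedCubeMemberPrinted_holds d' ℓ (by omega) hodd) hR1 hR1' hG

#print axioms gaugedBoundB8D_dentedMember_scalar_γ_of_thm312Dented

/-! ## §3 The crown modulo [4] Theorem 3.1 ∕ (1.101) for `T⁻¹` on the dented member only -/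

open Classical in
/-- ★★★ **PROPOSITION 6 (p. 99) AS `Node00.GaugedBoundB8D` AT EVERY DENTED CUBE MEMBER OF PRINT's BIG-BLOCK SUB-LATTICE, FOR ODD `L ≥ 5` AND `d ≥ 2`, MODULO (1.101) FOR
`T⁻¹` ON THE DENTED MEMBER ONLY** — §2 with its 𝒢-bound hypothesis `GBoundDentedCubeMemberPrinted (d−1) (L−1)` ([4] Thm 3.2 (3.48) on `{Ω′_j}`) DISCHARGED by this seat's dented
box transfer `gBoundDentedCubeMemberPrinted_of_one_le` (exact transfer to p21's level-0 box family; every `L ≥ 2`).  REMAINING HYPOTHESES, both OPEN named facts = [4] Theorem 3.1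
∕ [B8] (1.101) for `T⁻¹` on [15]'s dented sequence at its top truncation, in the two exponents the consumer uses: `Real1DentedCubeMemberPrinted (d−1) (L−1)` and
`Real1M4DentedCubeMemberPrinted (d−1) (L−1)` (p669491).  Conclusion verbatim the crown's.
[cite: Balaban1985RegularSpaces, Prop. 6 (1.135)–(1.138) p.99, p.98, (1.59) p.86, (1.91)–(1.92) p.91, (1.98) p.92, (1.101) p.93; Balaban1985Variational, (148)–(152) p.301; Balaban1985BackgroundPropagators, Thms 3.1–3.3 pp.398–399; Balaban1984PropagatorsII, Prop. 2.6 (2.136) p.247, Prop. 2.3 (2.87) p.238] -/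
theorem gaugedBoundB8D_dentedMember_scalar_γ_of_real1Dented (hd2 : 2 ≤ d) {L : ℕ} (hL5 : 5 ≤ L) (hodd : Odd L)
    (hR1 : Real1DentedCubeMemberPrinted (d - 1) (L - 1)) (hR1' : Real1M4DentedCubeMemberPrinted (d - 1) (L - 1)) :
    ∃ B₀ c₁ ρ₀ M₀ : ℝ, ∃ N₀ R₀ : ℕ, 1 ≤ B₀ ∧ 0 < c₁ ∧ ∀ (η : ℝ), 0 < η → ∀ {K : ℕ} {Ω : ℕ → Set (Site d)} (c : CubeB8D d L K Ω),
      -- PRINT'S SIDE CONDITIONS (p. 98) on the cube datum in the named facts' letters (`M_h = Lˢ`), above threshold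
      ∀ (s R : ℕ), 3 ≤ L ^ s → M₀ ≤ (L : ℝ) ^ (s + 1) → L ^ (s + 1) ∣ c.ρ → L ^ (s + 1) ∣ c.M → R * L ^ (s + 1) ≤ c.ρ → 2 * L ≤ R →
        R₀ ≤ R → N₀ + 1 ≤ R * L ^ (s + 1) → ρ₀ ≤ (c.ρ : ℝ) →
      -- THE DENT PREMISE ([6] (1.4)₂): `Ω_k` is a union of cubes of side `L^{s+1}Lᵏ` of the grid anchored at `□_k`'s fine lower corner `Lᵏ(c.a − c.ρ)`
      (∀ x y : Site d,
          blockMap (L ^ (s + 1) * L ^ c.k) (x - fun i => (L : ℤ) ^ c.k * (c.a i - c.ρ)) =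
            blockMap (L ^ (s + 1) * L ^ c.k) (y - fun i => (L : ℤ) ^ c.k * (c.a i - c.ρ)) → x ∈ Ω c.k → y ∈ Ω c.k) →
      ∀ (U₀ : Site d → Fin d → 𝔸ˣ), (∀ x κ, U₀ x κ ∈ unitaryUnits 𝔸) → ∀ (α₀ : ℝ), 0 < α₀ → InAk L K η α₀ Ω U₀ →
      7 * d * (L : ℝ) ^ 2 * c.M * α₀ ≤ c₁ →
      GaugedBoundB8D L η U₀ c (7 * d * (L : ℝ) ^ 2 * (5 * (d : ℝ) * L * B₀) * c.M * α₀) := by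
  obtain ⟨d', rfl⟩ : ∃ d', d = d' + 1 := ⟨d - 1, by omega⟩
  obtain ⟨ℓ, rfl⟩ : ∃ ℓ, L = ℓ + 1 := ⟨L - 1, by omega⟩
  have hG : GBoundDentedCubeMemberPrinted (d' + 1 - 1) (ℓ + 1 - 1) := by
    rw [Nat.add_sub_cancel, Nat.add_sub_cancel]
    exact gBoundDentedCubeMemberPrinted_of_one_le d' ℓ (by omega)
  exact gaugedBoundB8D_dentedMember_scalar_γ_of_thm312Dented (𝔸 := 𝔸) hd2 hL5 hodd hR1 hR1' hG

#print axioms gaugedBoundB8D_dentedMember_scalar_γ_of_real1Dented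

end Literature.MathematicalPhysics.QuantumFieldTheory.Balaban1983to89.B8Prop6DentedCubeMemberScalarGammaOfReal1

end
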